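import Literature.NumberTheory.Automorphic.Liu2021.AppendixC.HeckeEndomorphismPushPull
import Literature.NumberTheory.Automorphic.Liu2021.AlbaneseMapPiecewise
import Literature.AlgebraicGeometry.ComplexMultiplication.RationalCMStructureBaseChange
import HarnessLib

/-!
# The Hecke endomorphism `[KgK]` read on a piecewise model `Y ⟶ A_K ⊗ L`: the complex push–pull WORD (d6 `stub_RosH` glue, leg (N))

Topic `NumberTheory/Automorphic/Liu2021/AppendixC`; namespace `Literature.NumberTheory.Automorphic.Liu2021.AppendixC.Sec42Data.HeckeTranslates`.
PROOF FILE (theorems only; no definition, no named fact, no instance, no `sorry`).  Sequel of ★ `HeckeEndomorphismPushPull` (P3) and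
★ `Liu2021/AlbaneseMapPiecewise` (N1).

SETTING.  A §4.2 datum `C` over the CM extension `E/F` ([Liu2021] §4.2 l. 2053–2074: levels `K`, compactified Shimura varieties `X_K`,
Albanese varieties `A_K = Alb(X_K)`), Hecke translates `T`, row (D) `hD`, small levels `N ≤ K` with `N` normalised by `K`, an Albanese
trace `t : A_K ⟶ A_N` of the level cover and a transversal `s` of `KgK/K` as in (P3); a field extension `L/E` (`L = ℂ` at the d6 node);
and PIECEWISE MODELS of `A_N ⊗ L` and `A_K ⊗ L`: finite families of `L`-schemes `E_N c′`, `E_K c` («pieces» of `X_N ⊗ L`, `X_K ⊗ L`)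
with Albanese data `J_N c′`, `J_K c` (Milne's form ★ `Motives.Jacobian`), abelian varieties `Y_N`, `Y_K` with biproduct presentations
`πY/ιY` (only `Σ_c πY_c ≫ ιY_c = 𝟙` is used), HOMOMORPHISMS `v_N : Y_N ⟶ A_N ⊗ L`, `v_K : Y_K ⟶ A_K ⊗ L` (isogenies at the node — not used
here), and the two `α`-COMPATIBILITY laws of ★ `Albanese.exists_isGalois_isLimit_fan_baseChange_compat` for the inclusions `ιY_c ≫ v`
(`lY c ≫ (∇X ↪ X × X)_L = (eY c × eY c) ≫ μ`, `lY c ≫ (α_X)_L = diff_c ≫ (ιY c ≫ v)`).  PIECE MAPS `tp γ c′ : E_N c′ ⟶ E_K (φ γ c′)` of the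
translates `(T_γ)_L` (`tp ≫ eY_K = eY_N ≫ (T_γ)_L`, ★ `Morphisms/CofanPieceMap`).

* **`albTr_baseChange_word`** — `v_N ≫ (Alb T_γ)_L = W_γ ≫ v_K` with the Y-LEVEL WORD `W_γ := Σ_{c′} πY_N c′ ≫ Nm_{tp γ c′} ≫ ιY_K (φ γ c′)`
  ((N1) ★ `Albanese.inj_comp_map_baseChange_eq_pushforward_comp_inj` at `ι := ιY ≫ v` + `Σ πY ≫ ιY = 𝟙`);
* `trace_baseChange_word_of_cancel` — the trace side: if a Y-level trace word `Wt : Y_K ⟶ Y_N` is PINNED like `t`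
  (`W_u ≫ Wt = Σ_δ W_δ` for the words of the level cover `u^N_K = T_1` and of the deck translates `T_δ`, `δ ∈ K`) and `W_u` is
  right-cancellable, then `Wt ≫ v_N = v_K ≫ t_L` ([LangeRodriguez2022] Prop. 3.5.1 shape; proof as ★ (J-a) `trace_baseChange_comm`);
* **`word_comp_eq_comp_baseChange_pushPull`** — for `word := Wt ≫ Σ_{γ ∈ s} W_γ : End Y_K`: `word ≫ v_K = v_K ≫ (t ≫ Σ_γ Alb T_γ)_L`;
* **`endAlgebraBaseChange_heckeEnd`** — `End⁰(A_K) → End⁰(A_K ⊗ L)` sends `[KgK]` to `(card ι)⁻¹ · (1 ⊗ (t ≫ Σ_γ Alb T_γ)_L)` ((P3) ★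
  `heckeEnd_eq_pushPull` + ★ `endAlgebraBaseChange_algebraMap_mul_of`);
* **`algEquiv_symm_endAlgebraBaseChange_heckeEnd_eq_word`** — for an algebra isomorphism `e : End⁰(Y_K) ≃ End⁰(A_K ⊗ L)` MATCHED to
  `v_K` (`ψ ≫ v_K = v_K ≫ φ → e (1 ⊗ ψ) = 1 ⊗ φ`, ★ (J-b) `IsIsogeny.exists_endAlgebra_algEquiv`): `e⁻¹ ([KgK]_L) = (card ι)⁻¹ · (1 ⊗ word)` —
  THE WORD LEMMA the `stub_RosH` composition consumes (A-p02 (g14) frame `RosHGlueFrame` v4, `rhoModel`), after which the level adjoints of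
  `[KgK]` are those of an explicit push–pull of piece Jacobians (leg (L)).

Cell `hodgecm-mathlib` (D-0151), crux `HLiu418` = stmt-HodgeConjecture-24832, d6 line road (P), `stub_RosH` glue leg (N) (A-plan2 (g12)
2026-08-30 04:34Z).  COUNT-NEUTRAL capital: HC_CM is proved only modulo the 7 printed citations until rung 0 closes; nothing here
discharges a binder.

## References
* [Liu2021] Y. Liu, *Fourier–Jacobi cycles and arithmetic relative trace formula*, Camb. J. Math. 9 (2021): §2.1 proof of the
  Proposition (FJcycle.tex l. 1194–1200), Def. 2.3 (l. 1206–1208), §4.2 (l. 2070–2074), p. 133 (before (D.3)).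
* [LangeRodriguez2022] H. Lange, R. E. Rodríguez, *Decomposition of Jacobians by Prym Varieties*, LNM 2310 (2022), §3.5.1 Prop. 3.5.1 (p. 65).
* [Lange2023AbelianVarietiesComplex] H. Lange, *Abelian Varieties over the Complex Numbers* (2023), §4.5.2 (the norm map `N_f`).
* [MumfordAV1970] D. Mumford, *Abelian Varieties* (1970), §19 (`End⁰ = ℚ ⊗ End`, base change of endomorphisms).
* [Bump1997] D. Bump, *Automorphic Forms and Representations* (1997), §4.2 Prop. 4.2.3.
-/

set_option autoImplicit false

noncomputable section

open CategoryTheory CategoryTheory.Limits AlgebraicGeometry MonoidalCategory CartesianMonoidalCategory NumberField Function MulAction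
open Literature.AlgebraicGeometry.Motives

namespace Literature.NumberTheory.Automorphic.Liu2021.AppendixC

open AbelianVariety (bcSpec bcFunctor endAlgebra rationalTateModuleMap endAlgebraBaseChange)

-- `(A.baseChange L).X` is `(bcFunctor E L).obj A.X` only up to unfolding `AbelianVariety.baseChange` (as in the ★ fan files)
set_option backward.isDefEq.respectTransparency false

variable {F E : Type} [Field F] [NumberField F] [IsTotallyReal F] [Field E] [NumberField E] [Algebra F E]
  [IsTotallyComplex E] [Algebra.IsQuadraticExtension F E]
variable {P5 : PropC5Data F E} {isotropicAt : ℕ → Prop}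

namespace Sec42Data.HeckeTranslates

variable {C : Sec42Data P5 isotropicAt} (T : C.HeckeTranslates) (L : Type) [Field L] [Algebra E L]
variable {N K : C5.SmallLevel C.S.K₀}
-- piecewise model of `A_N ⊗ L`
variable {CN : Type} [Fintype CN] (EN : CN → SchemeOver L) (eN : ∀ c, EN c ⟶ (bcFunctor E L).obj (C.X N))
  (JN : ∀ c, Jacobian (EN c)) (YN : AbelianVariety L) (πN : ∀ c, YN ⟶ (JN c).J) (ιN : ∀ c, (JN c).J ⟶ YN)
  (vN : YN ⟶ (C.A N).baseChange L) (lN : ∀ c, EN c ⊗ EN c ⟶ (bcFunctor E L).obj (C.alb N).nabla.N)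
-- piecewise model of `A_K ⊗ L`
variable {CK : Type} (EK : CK → SchemeOver L) (eK : ∀ c, EK c ⟶ (bcFunctor E L).obj (C.X K))
  (JK : ∀ c, Jacobian (EK c)) (YK : AbelianVariety L) (ιK : ∀ c, (JK c).J ⟶ YK)
  (vK : YK ⟶ (C.A K).baseChange L) (lK : ∀ c, EK c ⊗ EK c ⟶ (bcFunctor E L).obj (C.alb K).nabla.N)

/-! ## §1 One translate: `v_N ≫ (Alb T_γ)_L = W_γ ≫ v_K` -/

/-- **The Y-level word of ONE translate**: for `T_γ : X_N → X_K` (`γ⁻¹Nγ ⊆ K`) with piece maps `tp c′ : E_N c′ ⟶ E_K (φ c′)` of `(T_γ)_L`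
and `α`-compatible models at both levels, `v_N ≫ (Alb T_γ)_L = (Σ_{c′} πY_N c′ ≫ Nm_{tp c′} ≫ ιY_K (φ c′)) ≫ v_K` — (N1) ★
`Albanese.inj_comp_map_baseChange_eq_pushforward_comp_inj` at the inclusions `ιY ≫ v`, summed over `Σ πY_N ≫ ιY_N = 𝟙`
(`Alb T_γ = Albanese.map T_γ` by definition of ★ `albTr`). [cite: Liu2021, Def. 2.3 (FJcycle.tex l. 1206–1208), §2.1 proof of the Proposition (l. 1194–1200) and §4.2 (l. 2074)]
[cite: Lange2023AbelianVarietiesComplex, §4.5.2 (the norm map N_f)] -/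
theorem albTr_baseChange_word (htotN : ∑ c, πN c ≫ ιN c = 𝟙 YN)
    (hlN : ∀ c, lN c ≫ (bcFunctor E L).map (C.alb N).nabla.incl = (eN c ⊗ₘ eN c) ≫ Functor.LaxMonoidal.μ (bcFunctor E L) (C.X N) (C.X N))
    (hlαN : ∀ c, lN c ≫ (bcFunctor E L).map (C.alb N).α = (JN c).diff ≫ (ιN c ≫ vN).hom.hom.hom)
    (hlK : ∀ c, lK c ≫ (bcFunctor E L).map (C.alb K).nabla.incl = (eK c ⊗ₘ eK c) ≫ Functor.LaxMonoidal.μ (bcFunctor E L) (C.X K) (C.X K))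
    (hlαK : ∀ c, lK c ≫ (bcFunctor E L).map (C.alb K).α = (JK c).diff ≫ (ιK c ≫ vK).hom.hom.hom)
    (γ : C.G) (hγ : C5.HeckeLE γ N K) (φ : CN → CK) (tp : ∀ c', EN c' ⟶ EK (φ c'))
    (htp : ∀ c', tp c' ≫ eK (φ c') = eN c' ≫ (bcFunctor E L).map (T.tr γ N K hγ)) :
    vN ≫ AbelianVariety.Hom.baseChange L (T.albTr γ N K hγ) =
      (∑ c', πN c' ≫ (JN c').pushforward (JK (φ c')) (tp c') ≫ ιK (φ c')) ≫ vK := by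
  have key : ∀ c', (ιN c' ≫ vN) ≫ AbelianVariety.Hom.baseChange L (T.albTr γ N K hγ) =
      (JN c').pushforward (JK (φ c')) (tp c') ≫ ιK (φ c') ≫ vK := fun c' =>
    (C.alb N).inj_comp_map_baseChange_eq_pushforward_comp_inj L (C.alb K) (T.tr γ N K hγ) EN eN JN (fun c => ιN c ≫ vN) lN
      EK eK JK (fun c => ιK c ≫ vK) lK φ tp hlN hlαN hlK hlαK htp c'
  calc vN ≫ AbelianVariety.Hom.baseChange L (T.albTr γ N K hγ)
      = (∑ c, πN c ≫ ιN c) ≫ vN ≫ AbelianVariety.Hom.baseChange L (T.albTr γ N K hγ) := by rw [htotN, Category.id_comp]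
    _ = ∑ c', πN c' ≫ ((ιN c' ≫ vN) ≫ AbelianVariety.Hom.baseChange L (T.albTr γ N K hγ)) := by
        rw [Preadditive.sum_comp]; exact Finset.sum_congr rfl fun c _ => by simp only [Category.assoc]
    _ = ∑ c', πN c' ≫ (JN c').pushforward (JK (φ c')) (tp c') ≫ ιK (φ c') ≫ vK := by
        exact Finset.sum_congr rfl fun c' _ => by rw [key c']
    _ = (∑ c', πN c' ≫ (JN c').pushforward (JK (φ c')) (tp c') ≫ ιK (φ c')) ≫ vK := by
        rw [Preadditive.sum_comp]; exact Finset.sum_congr rfl fun c _ => by simp only [Category.assoc]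

/-- **The same at a single level** (`T_δ : X_N → X_N`, `δ ∈ K`; the deck translates of the level cover): `v_N ≫ (Alb T_δ)_L = W_δ ≫ v_N`.
[cite: Liu2021, Def. 2.3 (FJcycle.tex l. 1206–1208) and §4.2 (l. 2070–2074)] [cite: Lange2023AbelianVarietiesComplex, §4.5.2 (the norm map N_f)] -/
theorem albTr_self_baseChange_word (htotN : ∑ c, πN c ≫ ιN c = 𝟙 YN)
    (hlN : ∀ c, lN c ≫ (bcFunctor E L).map (C.alb N).nabla.incl = (eN c ⊗ₘ eN c) ≫ Functor.LaxMonoidal.μ (bcFunctor E L) (C.X N) (C.X N))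
    (hlαN : ∀ c, lN c ≫ (bcFunctor E L).map (C.alb N).α = (JN c).diff ≫ (ιN c ≫ vN).hom.hom.hom)
    (δ : C.G) (hδ : C5.HeckeLE δ N N) (φ : CN → CN) (tp : ∀ c', EN c' ⟶ EN (φ c'))
    (htp : ∀ c', tp c' ≫ eN (φ c') = eN c' ≫ (bcFunctor E L).map (T.tr δ N N hδ)) :
    vN ≫ AbelianVariety.Hom.baseChange L (T.albTr δ N N hδ) =
      (∑ c', πN c' ≫ (JN c').pushforward (JN (φ c')) (tp c') ≫ ιN (φ c')) ≫ vN :=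
  T.albTr_baseChange_word L EN eN JN YN πN ιN vN lN EN eN JN YN ιN vN lN htotN hlN hlαN hlN hlαN δ hδ φ tp htp

/-! ## §2 The trace side: `Wt ≫ v_N = v_K ≫ t_L` from the Y-level pinning -/

/-- **The Y-level trace word intertwines the Albanese trace**, by cancellation ([LangeRodriguez2022] Prop. 3.5.1 shape, as ★ (J-a)
`trace_baseChange_comm`): let `t : A_K ⟶ A_N` be pinned by `Alb_u ≫ t = Σ_i Alb T_{δ_i}` ((P3)'s trace), `Wu : Y_N ⟶ Y_K` a Y-level word
intertwining `Alb_u` (`v_N ≫ (Alb_u)_L = Wu ≫ v_K`, §1 at `γ = 1`), `Wδ i` words intertwining the `Alb T_{δ_i}` (§1), and `Wt : Y_K ⟶ Y_N`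
pinned at the Y-level by `Wu ≫ Wt = Σ_i Wδ i`; if `Wu` is right-cancellable, then `Wt ≫ v_N = v_K ≫ t_L`.
[cite: LangeRodriguez2022, §3.5.1 Prop. 3.5.1 (p. 65)] [cite: Liu2021, §4.2 (FJcycle.tex l. 2070–2074)] -/
theorem trace_baseChange_word_of_cancel (h : N ≤ K) {ι : Type*} [Fintype ι] (δ : ι → C.G) (hδ : ∀ i, δ i ∈ K.1.1)
    (hn : ∀ k ∈ K.1.1, C5.HeckeLE k N N) (t : C.A K ⟶ C.A N)
    (ht : C.Atr (homOfLE h) ≫ t = ∑ i, T.albTr (δ i) N N (hn _ (hδ i)))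
    (Wu : YN ⟶ YK) (hWu : vN ≫ AbelianVariety.Hom.baseChange L (C.Atr (homOfLE h)) = Wu ≫ vK)
    (Wδ : ι → (YN ⟶ YN)) (hWδ : ∀ i, vN ≫ AbelianVariety.Hom.baseChange L (T.albTr (δ i) N N (hn _ (hδ i))) = Wδ i ≫ vN)
    (Wt : YK ⟶ YN) (hWt : Wu ≫ Wt = ∑ i, Wδ i)
    (hcancel : ∀ ⦃Z : AbelianVariety L⦄ ⦃a b : YK ⟶ Z⦄, Wu ≫ a = Wu ≫ b → a = b) :
    Wt ≫ vN = vK ≫ AbelianVariety.Hom.baseChange L t := by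
  refine hcancel ?_
  have hsum : vN ≫ AbelianVariety.Hom.baseChange L (∑ i, T.albTr (δ i) N N (hn _ (hδ i))) = (∑ i, Wδ i) ≫ vN := by
    have e1 : AbelianVariety.Hom.baseChange L (∑ i, T.albTr (δ i) N N (hn _ (hδ i))) =
        ∑ i, AbelianVariety.Hom.baseChange L (T.albTr (δ i) N N (hn _ (hδ i))) :=
      map_sum (AddMonoidHom.mk' (fun g : C.A N ⟶ C.A N => AbelianVariety.Hom.baseChange L g) (AbelianVariety.Hom.baseChange_add L)) _ _
    rw [e1, Preadditive.comp_sum, Preadditive.sum_comp]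
    exact Finset.sum_congr rfl fun i _ => hWδ i
  rw [← Category.assoc, hWt, ← hsum, ← ht, AbelianVariety.Hom.baseChange_comp, ← Category.assoc, hWu, Category.assoc]

/-! ## §3 The word of `[KgK]` -/

section Word

variable (htotN : ∑ c, πN c ≫ ιN c = 𝟙 YN)
  (hlN : ∀ c, lN c ≫ (bcFunctor E L).map (C.alb N).nabla.incl = (eN c ⊗ₘ eN c) ≫ Functor.LaxMonoidal.μ (bcFunctor E L) (C.X N) (C.X N))
  (hlαN : ∀ c, lN c ≫ (bcFunctor E L).map (C.alb N).α = (JN c).diff ≫ (ιN c ≫ vN).hom.hom.hom)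
  (hlK : ∀ c, lK c ≫ (bcFunctor E L).map (C.alb K).nabla.incl = (eK c ⊗ₘ eK c) ≫ Functor.LaxMonoidal.μ (bcFunctor E L) (C.X K) (C.X K))
  (hlαK : ∀ c, lK c ≫ (bcFunctor E L).map (C.alb K).α = (JK c).diff ≫ (ιK c ≫ vK).hom.hom.hom)
  {s : Finset C.G} (hsN : ∀ γ ∈ s, C5.HeckeLE γ N K)
  (φ : ↥s → CN → CK) (tp : ∀ (γ : ↥s) (c' : CN), EN c' ⟶ EK (φ γ c'))
  (htp : ∀ (γ : ↥s) (c' : CN), tp γ c' ≫ eK (φ γ c') = eN c' ≫ (bcFunctor E L).map (T.tr (γ : C.G) N K (hsN γ γ.2)))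
  (t : C.A K ⟶ C.A N) (Wt : YK ⟶ YN) (hWt : Wt ≫ vN = vK ≫ AbelianVariety.Hom.baseChange L t)

include htotN hlN hlαN hlK hlαK htp hWt in
/-- **THE WORD INTERTWINES THE PUSH–PULL**: with `W_γ := Σ_{c′} πY_N c′ ≫ Nm_{tp γ c′} ≫ ιY_K (φ γ c′)` (§1) and a Y-level trace word `Wt`
intertwining `t` (§2 or any other source), the endomorphism `word := Wt ≫ Σ_{γ ∈ s} W_γ` of `Y_K` satisfies
`word ≫ v_K = v_K ≫ (t ≫ Σ_{γ ∈ s} Alb T_γ)_L` — the complex push–pull word over the honest push–pull of ★ (P3). [cite: Liu2021, §4.2 (FJcycle.tex l. 2074) and p. 133 (before (D.3))]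
[cite: Bump1997, §4.2 (Prop. 4.2.3)] [cite: Lange2023AbelianVarietiesComplex, §4.5.2 (the norm map N_f)] -/
theorem word_comp_eq_comp_baseChange_pushPull :
    (Wt ≫ ∑ γ ∈ s.attach, ∑ c', πN c' ≫ (JN c').pushforward (JK (φ γ c')) (tp γ c') ≫ ιK (φ γ c')) ≫ vK =
      vK ≫ AbelianVariety.Hom.baseChange L (t ≫ ∑ γ ∈ s.attach, T.albTr (γ : C.G) N K (hsN γ γ.2)) := by
  have hS : vN ≫ AbelianVariety.Hom.baseChange L (∑ γ ∈ s.attach, T.albTr (γ : C.G) N K (hsN γ γ.2)) =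
      (∑ γ ∈ s.attach, ∑ c', πN c' ≫ (JN c').pushforward (JK (φ γ c')) (tp γ c') ≫ ιK (φ γ c')) ≫ vK := by
    have e1 : AbelianVariety.Hom.baseChange L (∑ γ ∈ s.attach, T.albTr (γ : C.G) N K (hsN γ γ.2)) =
        ∑ γ ∈ s.attach, AbelianVariety.Hom.baseChange L (T.albTr (γ : C.G) N K (hsN γ γ.2)) :=
      map_sum (AddMonoidHom.mk' (fun g : C.A N ⟶ C.A K => AbelianVariety.Hom.baseChange L g) (AbelianVariety.Hom.baseChange_add L)) _ _
    rw [e1, Preadditive.comp_sum, Preadditive.sum_comp]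
    exact Finset.sum_congr rfl fun γ _ =>
      T.albTr_baseChange_word L EN eN JN YN πN ιN vN lN EK eK JK YK ιK vK lK htotN hlN hlαN hlK hlαK (γ : C.G) (hsN γ γ.2)
        (φ γ) (tp γ) (htp γ)
  rw [Category.assoc, ← hS, ← Category.assoc, hWt, Category.assoc, ← AbelianVariety.Hom.baseChange_comp]

end Word

/-! ## §4 `[KgK]` in `End⁰(A_K ⊗ L)` and, through a matched `e`, in `End⁰(Y_K)` -/

/-- **`End⁰(A_K) → End⁰(A_K ⊗ L)` on the Hecke endomorphism**: `([KgK])_L = (card ι)⁻¹ · (1 ⊗ (t ≫ Σ_{γ ∈ s} Alb T_γ)_L)` — (P3) ★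
`heckeEnd_eq_pushPull` pushed through ★ `endAlgebraBaseChange_algebraMap_mul_of` ([MumfordAV1970] §19: `End⁰ = ℚ ⊗ End` and base
change of endomorphisms). [cite: Liu2021, p. 133 (before (D.3)) and §4.2 (FJcycle.tex l. 2074)] [cite: MumfordAV1970, §19] [cite: Bump1997, §4.2 (Prop. 4.2.3)] -/
theorem endAlgebraBaseChange_heckeEnd (ℓ : ℕ) [Fact ℓ.Prime] (hD : T.IsogenyDescent)
    (hI : ∀ ⦃K K' : C5.SmallLevel C.S.K₀⦄ (f : K' ⟶ K), Function.Injective (rationalTateModuleMap ℓ (C.Atr f)).dualMap)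
    (h : N ≤ K) (hn : ∀ k ∈ K.1.1, C5.HeckeLE k N N)
    {ι : Type*} [Fintype ι] [Nonempty ι] (δ : ι → C.G) (hδ : ∀ i, δ i ∈ K.1.1) (t : C.A K ⟶ C.A N)
    (ht : C.Atr (homOfLE h) ≫ t = ∑ i, T.albTr (δ i) N N (hn _ (hδ i)))
    (g : C.G) (s : Finset C.G)
    (hs : Set.BijOn (fun x : C.G => (x : C.G ⧸ (K.1.1 : Subgroup C.G))) s (orbit K.1.1 (g : C.G ⧸ (K.1.1 : Subgroup C.G))))
    (hsN : ∀ γ ∈ s, C5.HeckeLE γ N K) :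
    endAlgebraBaseChange L (C.A K) (T.heckeEnd hD K g) =
      algebraMap ℚ ((C.A K).baseChange L).endAlgebra ((Fintype.card ι : ℚ))⁻¹ *
        endAlgebra.of ((C.A K).baseChange L)
          (AbelianVariety.Hom.baseChange L (t ≫ ∑ γ ∈ s.attach, T.albTr (γ : C.G) N K (hsN γ γ.2))) := by
  rw [T.heckeEnd_eq_pushPull ℓ hD hI h hn δ hδ t ht g s hs hsN, AbelianVariety.endAlgebraBaseChange_algebraMap_mul_of]

/-- **THE WORD LEMMA** (`stub_RosH` glue, leg (N)): for an algebra isomorphism `e : End⁰(Y_K) ≃ End⁰(A_K ⊗ L)` MATCHED to `v_K`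
(`ψ ≫ v_K = v_K ≫ φ → e (1 ⊗ ψ) = 1 ⊗ φ`, the shape ★ (J-b) `IsIsogeny.exists_endAlgebra_algEquiv` delivers for the comparison isogeny), the
Hecke endomorphism pulled back to `End⁰(Y_K)` is `(card ι)⁻¹ · (1 ⊗ word)` for ANY endomorphism `word` of `Y_K` with
`word ≫ v_K = v_K ≫ (t ≫ Σ_γ Alb T_γ)_L` — e.g. the complex push–pull word of §3. [cite: Liu2021, p. 133 (before (D.3)) and §4.2 (FJcycle.tex l. 2074)]
[cite: MumfordAV1970, §19] [cite: Bump1997, §4.2 (Prop. 4.2.3)] -/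
theorem algEquiv_symm_endAlgebraBaseChange_heckeEnd_eq_word (ℓ : ℕ) [Fact ℓ.Prime] (hD : T.IsogenyDescent)
    (hI : ∀ ⦃K K' : C5.SmallLevel C.S.K₀⦄ (f : K' ⟶ K), Function.Injective (rationalTateModuleMap ℓ (C.Atr f)).dualMap)
    (h : N ≤ K) (hn : ∀ k ∈ K.1.1, C5.HeckeLE k N N)
    {ι : Type*} [Fintype ι] [Nonempty ι] (δ : ι → C.G) (hδ : ∀ i, δ i ∈ K.1.1) (t : C.A K ⟶ C.A N)
    (ht : C.Atr (homOfLE h) ≫ t = ∑ i, T.albTr (δ i) N N (hn _ (hδ i)))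
    (g : C.G) (s : Finset C.G)
    (hs : Set.BijOn (fun x : C.G => (x : C.G ⧸ (K.1.1 : Subgroup C.G))) s (orbit K.1.1 (g : C.G ⧸ (K.1.1 : Subgroup C.G))))
    (hsN : ∀ γ ∈ s, C5.HeckeLE γ N K)
    (e : YK.endAlgebra ≃ₐ[ℚ] ((C.A K).baseChange L).endAlgebra)
    (he : ∀ (ψ : End YK) (φ' : End ((C.A K).baseChange L)), End.asHom ψ ≫ vK = vK ≫ End.asHom φ' →
      e (endAlgebra.of YK ψ) = endAlgebra.of ((C.A K).baseChange L) φ')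
    (word : End YK)
    (hword : End.asHom word ≫ vK =
      vK ≫ AbelianVariety.Hom.baseChange L (t ≫ ∑ γ ∈ s.attach, T.albTr (γ : C.G) N K (hsN γ γ.2))) :
    e.symm (endAlgebraBaseChange L (C.A K) (T.heckeEnd hD K g)) =
      algebraMap ℚ YK.endAlgebra ((Fintype.card ι : ℚ))⁻¹ * endAlgebra.of YK word := by
  have hew : e (endAlgebra.of YK word) =
      endAlgebra.of ((C.A K).baseChange L)
        (AbelianVariety.Hom.baseChange L (t ≫ ∑ γ ∈ s.attach, T.albTr (γ : C.G) N K (hsN γ γ.2))) := he word _ hword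
  rw [T.endAlgebraBaseChange_heckeEnd L ℓ hD hI h hn δ hδ t ht g s hs hsN, ← hew, map_mul, AlgEquiv.commutes,
    AlgEquiv.symm_apply_apply]

end Sec42Data.HeckeTranslates

end Literature.NumberTheory.Automorphic.Liu2021.AppendixC

end
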